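import Summits.QuantumFields.BalabanUV.T4Continuum.Support.ScalarCovariantGradComm
import Summits.QuantumFields.BalabanUV.Beta.AccretiveCombesThomas

/-!
# T⁴ programme, SUBSTRATE (shared lattice-gauge analysis library) — LEVEL-FREE DECAY OF THE GRADIENT ENTRIES `D_R·G′(U)` and `G′(U)·D_Rᴴ`
# of the covariant scalar averaged Green function (the second and third entries of the [B9] (3.42) SHAPE), constants depending on
# `(d, a′, α, τ, card o)` ONLY (file C of the gradient half of the decay chain)

Substrate cell `b2b-balaban-substrate-*`, seat p3; gradient half of the chain «level-free decay of the covariant scalar averaged Green function»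
(`ScalarCovariantCoercive` p217284 → `ScalarCovariantCTDefects` → `ScalarCovariantGreenDecay`; then `ScalarCovariantCTWeighted` → `ScalarCovariantGradComm`
→ `ScalarCovariantGreenGradDecay`).  Files 1–3 give, for `S_U = scalarOp n M a′ R T = D_RᴴD_R + a′n^dQ′(U)ᴴQ′(U)` on `Tor (fine n M) × o`, the
coercivity `γ_U = gammaU d a′ α τ`, the level-free row-defect budget `Jcov` and the decay of the ENTRIES of `S_U⁻¹` ([B9] =
[Balaban1985BackgroundPropagators] Thm 3.1 (3.42) p.397, FIRST entry, ℓ²-pairing shadow).  The rows also consume the DERIVATIVE entries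
«|(∇_UG′(U)λ)(x)|, |(G′(U)∇*_Uλ)(x)| ≤ B₀(L^jη)e^{−δ₀d(y,y′)}|λ|» (same display; NE3's reading `hT31` item 1 is open even at `U = 1` — header of
`Support/SliceFlatGaugeDecay`); the gradient half proves their level-free ℓ²-pairing shadows for the one-region model.

THIS FILE: from file 1's coercivity `Coercive γ_U S_U`, weight `rhoS` and rate `kappaU`, file 2's level-free row-defect bound, file A's weighted
Gram bound and file B's commutator size:
 * `gradC co d a′ α τ κ = (√γ_U + 2√d·co·(1+α)κ)/(γ_U − Jcov κ)`; **`sqrt_nsq_wvec_covGrad_inv_le`**: `‖e^{κρ_b}·(D_RS_U⁻¹v)‖ ≤ gradC·‖e^{κρ}v‖`;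
 * **`covGrad_scalarOp_inv_pairing_decay`**: for `u` on bonds whose base site has `ρ₀ ≥ R′`, `v` on sites with `ρ₀ ≤ 0`, `0 ≤ κ ≤ 1`,
   `Jcov κ < γ_U`: `|⟨u, D_RS_U⁻¹v⟩| ≤ e^{−κR′}·gradC·‖u‖‖v‖`; **`scalarOp_inv_covGradH_pairing_decay`** (`S_U⁻¹D_Rᴴ`, by Hermitian symmetry and
   the reversed weight `R′ − ρ₀`);
 * at the explicit rate `κ_U` of file 1, `gradConst co d a′ α τ = 2(√γ_U + 2√d·co·(1+α)κ_U)/γ_U` (`gradC_kappaU_le`) and the ENTRY forms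
   **`covGrad_scalarOp_inv_entry_decay_explicit`**, **`scalarOp_inv_covGradH_entry_decay_explicit`**:
   `‖(D_RS_U⁻¹)(((x,ν),α),(x′,α′))‖, ‖(S_U⁻¹D_Rᴴ)((x′,α′),((x,ν),α))‖ ≤ gradConst·e^{−κ_U·dist_∞(x,x′)/n}` for every level `n = L^j` and every
   torus with `n·M_μ ≥ 2`.

HONEST FRAMING (T4-DAG p. 1).  MODEL level: one region, global small field, ℓ²-pairing ∕ entry norms (no sup∕Hölder norms, no second
derivatives `Δ_UG′`), route = Combes–Thomas (OURS); constants OURS and crude.  NOT [B9] Thm 3.1 as printed; nothing printed is a hypothesis;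
no `def … : Prop` fact; spine 0/9 unchanged; NOT infinite volume ∕ mass gap ∕ Clay.  HONEST DEPENDENCY: continuum YM on T⁴ ⇐ BetaPertH ∧
nine spine estimates (0/9 proved); BetaPertH ⇐ (D1) ∧ (D4) ∧ CAP+tail; G-an2-4 gates asym, D1 and NE2/3/4.  ABSOLUTE RULE kept; no `sorry`.
-/

noncomputable section

open scoped BigOperators ComplexConjugate Matrix Matrix.Norms.L2Operator Kronecker ComplexOrder

namespace Summit.QuantumFields.BalabanUV.T4Continuum.ScalarCovariantGreenGradDecay

open Literature.MathematicalPhysics.QuantumFieldTheory.Balaban1983to89.B5Prop11Plancherel (Tor fine unitVec)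
open Literature.MathematicalPhysics.QuantumFieldTheory.Balaban1983to89.B5Blocks16 (blockOf)
open Literature.MathematicalPhysics.QuantumFieldTheory.Balaban1983to89.B5Prop11Lower (nsq nsq_nonneg norm_star_dotProduct_le)
open Literature.MathematicalPhysics.QuantumFieldTheory.Balaban1983to89.Beta.DeltaACombesThomas (ctRowDefect)
open Literature.MathematicalPhysics.QuantumFieldTheory.Balaban1983to89.Beta.TorusG0Decay (ldist ldist_self)
open Literature.MathematicalPhysics.QuantumFieldTheory.Balaban1983to89.Beta.CombesThomasFormOp (distTo le_distTo distTo_le_zero_of_mem)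
open Summit.QuantumFields.BalabanUV.Beta.AccretiveCombesThomas (nsq_single)
open Summit.QuantumFields.BalabanUV.T4Continuum
open Summit.QuantumFields.BalabanUV.T4Continuum.KroneckerLift
open Summit.QuantumFields.BalabanUV.T4Continuum.BlockMultiplication
open Summit.QuantumFields.BalabanUV.T4Continuum.GaugeTermDecomposition
open Summit.QuantumFields.BalabanUV.T4Continuum.ScalarCovariantLaplacian
open Summit.QuantumFields.BalabanUV.T4Continuum.CoerciveInverseTower (Coercive isUnit_of_coercive)
open Summit.QuantumFields.BalabanUV.T4Continuum.ScalarCovariantCoercive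
open Summit.QuantumFields.BalabanUV.T4Continuum.ScalarCovariantCTDefects
open Summit.QuantumFields.BalabanUV.T4Continuum.ScalarCovariantCTWeighted
open Summit.QuantumFields.BalabanUV.T4Continuum.ScalarCovariantGradComm

section Decay

variable {d : ℕ} {o : Type*} [Fintype o] [DecidableEq o]
variable (n : ℕ) [NeZero n] (M : Fin d → ℕ) [hM : ∀ μ, NeZero (M μ)]
variable {a' : ℝ} {R : Fin d → (Tor (fine n M) → Matrix o o ℂ)} {T : Tor (fine n M) → Matrix o o ℂ} {α τ : ℝ}

/-- the gradient decay constant `(√γ_U + 2√d·card o·(1+α)κ)/(γ_U − Jcov κ)`. [folklore] -/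
def gradC (co d : ℕ) (a' α τ κ : ℝ) : ℝ :=
  (Real.sqrt (gammaU d a' α τ) + 2 * Real.sqrt d * co * (1 + α) * κ) / (gammaU d a' α τ - Jcov co d a' α τ κ)

/-- **WEIGHTED ℓ² BOUND FOR THE GRADIENT OF THE SOLUTION**: with `x = S_U⁻¹v`, any `1/n`-Lipschitz site weight `ρ₀` with block oscillation
`≤ 1`, `0 ≤ κ ≤ 1`, `Jcov κ < γ_U`: `‖e^{κρ_b}·(D_Rx)‖ ≤ gradC·‖e^{κρ}v‖`. [folklore] -/
theorem sqrt_nsq_wvec_covGrad_inv_le (ha' : 0 < a') (hα : 0 ≤ α) (hτ : 0 ≤ τ) (h2 : ∀ μ, 2 ≤ fine n M μ)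
    (hR : ∀ μ x, ‖connS (fine n M) ((n : ℕ) : ℂ) R μ x‖ ≤ α) (hT : ∀ x, ‖T x - 1‖ ≤ τ)
    {ρ₀ : Tor (fine n M) → ℝ} (hlip : ∀ x ν, |ρ₀ (x + unitVec (fine n M) ν) - ρ₀ x| ≤ 1 / n)
    (hosc : ∀ x x', blockOf n M x = blockOf n M x' → |ρ₀ x - ρ₀ x'| ≤ 1)
    {κ : ℝ} (hκ0 : 0 ≤ κ) (hκ1 : κ ≤ 1) (hJ : Jcov (Fintype.card o) d a' α τ κ < gammaU d a' α τ) (v : Tor (fine n M) × o → ℂ) :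
    Real.sqrt (nsq (wvec κ (bondW n M ρ₀) (covGrad (fine n M) ((n : ℕ) : ℂ) R *ᵥ ((scalarOp n M a' R T)⁻¹ *ᵥ v))))
      ≤ gradC (Fintype.card o) d a' α τ κ * Real.sqrt (nsq (wvec κ (siteW n M ρ₀) v)) := by
  set A := scalarOp n M a' R T with hA
  set γ := gammaU d a' α τ with hγdef
  set J := Jcov (Fintype.card o) d a' α τ κ with hJdef
  have hJ0 : 0 ≤ J := Jcov_nonneg _ _ ha'.le hα κ
  have hγ0 : 0 < γ := hJ0.trans_lt hJ
  have hm0 : 0 < γ - J := by linarith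
  have hcoer : Coercive γ A := coercive_scalarOp n M ha' hα hτ hR hT
  have hdef : ∀ e, ctRowDefect A κ (siteW n M ρ₀) e ≤ J := ctRowDefect_scalarOp_le_uniform n M ha'.le hα hτ hR hT hlip hosc
  have hunit : IsUnit A.det := (Matrix.isUnit_iff_isUnit_det _).mp (isUnit_scalarOp n M ha' hα hτ hR hT hγ0)
  set x := A⁻¹ *ᵥ v with hx
  have hAx : A *ᵥ x = v := by rw [hx, Matrix.mulVec_mulVec, Matrix.mul_nonsing_inv _ hunit, Matrix.one_mulVec]
  -- the Gram shape of `S_U`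
  have hAX : A = (covGrad (fine n M) ((n : ℕ) : ℂ) R)ᴴ * covGrad (fine n M) ((n : ℕ) : ℂ) R
      + (a' : ℂ) • ((Bs o n M * siteMul T)ᴴ * (Bs o n M * siteMul T)) := by
    rw [hA, scalarOp, covGrad_conjTranspose_mul_covGrad]
  have hY : ((a' : ℂ) • ((Bs o n M * siteMul T)ᴴ * (Bs o n M * siteMul T))).PosSemidef := by
    have h : ((a' : ℂ) • ((Bs o n M * siteMul T)ᴴ * (Bs o n M * siteMul T)))
        = ((((Real.sqrt a' : ℝ) : ℂ)) • (Bs o n M * siteMul T))ᴴ * ((((Real.sqrt a' : ℝ) : ℂ)) • (Bs o n M * siteMul T)) := by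
      rw [Matrix.conjTranspose_smul, Matrix.smul_mul, Matrix.mul_smul, smul_smul, Complex.star_def, Complex.conj_ofReal,
        ← Complex.ofReal_mul, Real.mul_self_sqrt ha'.le]
    rw [h]; exact Matrix.posSemidef_conjTranspose_mul_self _
  -- (a) the weighted Gram bound: `‖D_R z‖ ≤ √γ/(γ−J)·‖w‖`
  have hgram := weighted_gram_bound hAX hY (scalarOp_isHermitian n M a' R T) κ (siteW n M ρ₀) hcoer hdef hJ0 hJ hAx
  -- (b) the commutator: `‖Ecomm z‖ ≤ ‖Ecomm‖·‖z‖ ≤ ‖Ecomm‖/(γ−J)·‖w‖`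
  have hsol := weighted_solution_bound A (scalarOp_isHermitian n M a' R T) κ (siteW n M ρ₀) hcoer hdef hAx
  have hE := opNorm_Ecomm_le n M hκ0 hκ1 hα h2 hlip hR (ρ₀ := ρ₀)
  set z := wvec κ (siteW n M ρ₀) x with hz
  set w := wvec κ (siteW n M ρ₀) v with hw
  set E := Ecomm n M κ ρ₀ R with hEdef
  have hW0 : 0 ≤ Real.sqrt (nsq w) := Real.sqrt_nonneg _
  have h1 : Real.sqrt (nsq (covGrad (fine n M) ((n : ℕ) : ℂ) R *ᵥ z)) ≤ Real.sqrt γ / (γ - J) * Real.sqrt (nsq w) := by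
    calc Real.sqrt (nsq (covGrad (fine n M) ((n : ℕ) : ℂ) R *ᵥ z)) ≤ Real.sqrt (γ / (γ - J) ^ 2 * nsq w) := Real.sqrt_le_sqrt hgram
      _ = Real.sqrt γ / (γ - J) * Real.sqrt (nsq w) := by
          rw [Real.sqrt_mul (by positivity), Real.sqrt_div' _ (sq_nonneg _), Real.sqrt_sq hm0.le]
  have h2' : Real.sqrt (nsq (E *ᵥ z)) ≤ ‖E‖ * Real.sqrt (nsq z) := by
    calc Real.sqrt (nsq (E *ᵥ z)) ≤ Real.sqrt (‖E‖ ^ 2 * nsq z) := Real.sqrt_le_sqrt (GaugeTermCoercivity.nsq_mulVec_le_rect E z)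
      _ = ‖E‖ * Real.sqrt (nsq z) := by rw [Real.sqrt_mul (sq_nonneg _), Real.sqrt_sq (norm_nonneg _)]
  have hZ : Real.sqrt (nsq z) ≤ Real.sqrt (nsq w) / (γ - J) := by rw [le_div_iff₀ hm0, mul_comm]; exact hsol
  have h2 : Real.sqrt (nsq (E *ᵥ z)) ≤ (2 * Real.sqrt d * Fintype.card o * (1 + α) * κ) / (γ - J) * Real.sqrt (nsq w) := by
    calc Real.sqrt (nsq (E *ᵥ z)) ≤ ‖E‖ * Real.sqrt (nsq z) := h2'
      _ ≤ (2 * Real.sqrt d * Fintype.card o * (1 + α) * κ) * (Real.sqrt (nsq w) / (γ - J)) :=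
          mul_le_mul hE hZ (Real.sqrt_nonneg _) (by positivity)
      _ = _ := by ring
  -- (c) triangle inequality in `√nsq`
  have htri : Real.sqrt (nsq (covGrad (fine n M) ((n : ℕ) : ℂ) R *ᵥ z + E *ᵥ z))
      ≤ Real.sqrt (nsq (covGrad (fine n M) ((n : ℕ) : ℂ) R *ᵥ z)) + Real.sqrt (nsq (E *ᵥ z)) := by
    have key : ∀ f g : (Tor (fine n M) × Fin d) × o → ℂ, Real.sqrt (nsq (f + g)) ≤ Real.sqrt (nsq f) + Real.sqrt (nsq g) := by
      intro f g
      have e1 : ∀ h : (Tor (fine n M) × Fin d) × o → ℂ, Real.sqrt (nsq h) = ‖(WithLp.equiv 2 _).symm h‖ := by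
        intro h
        rw [EuclideanSpace.norm_eq, nsq]; rfl
      rw [e1, e1, e1, show (WithLp.equiv 2 ((Tor (fine n M) × Fin d) × o → ℂ)).symm (f + g)
          = (WithLp.equiv 2 _).symm f + (WithLp.equiv 2 _).symm g from rfl]
      exact norm_add_le _ _
    exact key _ _
  rw [wvec_covGrad_mulVec, ← hz, ← hEdef]
  calc _ ≤ Real.sqrt (nsq (covGrad (fine n M) ((n : ℕ) : ℂ) R *ᵥ z)) + Real.sqrt (nsq (E *ᵥ z)) := htri
    _ ≤ Real.sqrt γ / (γ - J) * Real.sqrt (nsq w) + (2 * Real.sqrt d * Fintype.card o * (1 + α) * κ) / (γ - J) * Real.sqrt (nsq w) :=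
        add_le_add h1 h2
    _ = gradC (Fintype.card o) d a' α τ κ * Real.sqrt (nsq w) := by rw [gradC, ← hγdef, ← hJdef]; ring

/-- **LEVEL-FREE DECAY OF `D_R·G′(U)` (the second entry of the (3.42) SHAPE), PAIRING FORM**: for `u` supported on bonds whose base
site has `ρ₀ ≥ R′` and `v` on sites with `ρ₀ ≤ 0`: `|⟨u, D_RS_U⁻¹v⟩| ≤ e^{−κR′}·gradC·‖u‖‖v‖`.
[cite: Balaban1985BackgroundPropagators, Thm 3.1 (3.42) p.397 (second entry, ℓ²-pairing shadow, one region; route and constants ours)] [folklore] -/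
theorem covGrad_scalarOp_inv_pairing_decay (ha' : 0 < a') (hα : 0 ≤ α) (hτ : 0 ≤ τ) (h2 : ∀ μ, 2 ≤ fine n M μ)
    (hR : ∀ μ x, ‖connS (fine n M) ((n : ℕ) : ℂ) R μ x‖ ≤ α) (hT : ∀ x, ‖T x - 1‖ ≤ τ)
    {ρ₀ : Tor (fine n M) → ℝ} (hlip : ∀ x ν, |ρ₀ (x + unitVec (fine n M) ν) - ρ₀ x| ≤ 1 / n)
    (hosc : ∀ x x', blockOf n M x = blockOf n M x' → |ρ₀ x - ρ₀ x'| ≤ 1)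
    {κ R' : ℝ} (hκ0 : 0 ≤ κ) (hκ1 : κ ≤ 1) (hJ : Jcov (Fintype.card o) d a' α τ κ < gammaU d a' α τ)
    {u : (Tor (fine n M) × Fin d) × o → ℂ} {v : Tor (fine n M) × o → ℂ}
    (hu : ∀ b, u b ≠ 0 → R' ≤ ρ₀ b.1.1) (hv : ∀ e, v e ≠ 0 → ρ₀ e.1 ≤ 0) :
    ‖star u ⬝ᵥ (covGrad (fine n M) ((n : ℕ) : ℂ) R *ᵥ ((scalarOp n M a' R T)⁻¹ *ᵥ v))‖
      ≤ Real.exp (-(κ * R')) * gradC (Fintype.card o) d a' α τ κ * (Real.sqrt (nsq u) * Real.sqrt (nsq v)) := by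
  set y := covGrad (fine n M) ((n : ℕ) : ℂ) R *ᵥ ((scalarOp n M a' R T)⁻¹ *ᵥ v) with hy
  have hJ0 : 0 ≤ Jcov (Fintype.card o) d a' α τ κ := Jcov_nonneg _ _ ha'.le hα κ
  have hC0 : 0 ≤ gradC (Fintype.card o) d a' α τ κ := by
    unfold gradC; exact div_nonneg (by positivity) (by linarith)
  have hmain := sqrt_nsq_wvec_covGrad_inv_le n M ha' hα hτ h2 hR hT hlip hosc hκ0 hκ1 hJ v
  have hw : Real.sqrt (nsq (wvec κ (siteW n M ρ₀) v)) ≤ Real.sqrt (nsq v) := Real.sqrt_le_sqrt (nsq_wvec_le_of_nonpos hκ0 hv)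
  have hu' := sqrt_nsq_wvec_neg_le hκ0 (ρ := bondW n M ρ₀) (u := u) hu
  rw [dotProduct_wvec κ (bondW n M ρ₀) u y]
  calc ‖star (wvec (-κ) (bondW n M ρ₀) u) ⬝ᵥ wvec κ (bondW n M ρ₀) y‖
      ≤ Real.sqrt (nsq (wvec (-κ) (bondW n M ρ₀) u)) * Real.sqrt (nsq (wvec κ (bondW n M ρ₀) y)) := norm_star_dotProduct_le _ _
    _ ≤ (Real.exp (-(κ * R')) * Real.sqrt (nsq u)) * (gradC (Fintype.card o) d a' α τ κ * Real.sqrt (nsq v)) :=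
        mul_le_mul hu' (hmain.trans (mul_le_mul_of_nonneg_left hw hC0)) (Real.sqrt_nonneg _) (by positivity)
    _ = _ := by ring

/-- **LEVEL-FREE DECAY OF `G′(U)·D_Rᴴ` (the third entry of the (3.42) SHAPE), PAIRING FORM**: for `u` on sites with `ρ₀ ≥ R′` and `v` on bonds
whose base site has `ρ₀ ≤ 0`: `|⟨u, S_U⁻¹D_Rᴴv⟩| ≤ e^{−κR′}·gradC·‖u‖‖v‖` (Hermitian symmetry of `S_U⁻¹` and the reversed weight `R′ − ρ₀`).
[cite: Balaban1985BackgroundPropagators, Thm 3.1 (3.42) p.397 (third entry, ℓ²-pairing shadow, one region; route and constants ours)] [folklore] -/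
theorem scalarOp_inv_covGradH_pairing_decay (ha' : 0 < a') (hα : 0 ≤ α) (hτ : 0 ≤ τ) (h2 : ∀ μ, 2 ≤ fine n M μ)
    (hR : ∀ μ x, ‖connS (fine n M) ((n : ℕ) : ℂ) R μ x‖ ≤ α) (hT : ∀ x, ‖T x - 1‖ ≤ τ)
    {ρ₀ : Tor (fine n M) → ℝ} (hlip : ∀ x ν, |ρ₀ (x + unitVec (fine n M) ν) - ρ₀ x| ≤ 1 / n)
    (hosc : ∀ x x', blockOf n M x = blockOf n M x' → |ρ₀ x - ρ₀ x'| ≤ 1)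
    {κ R' : ℝ} (hκ0 : 0 ≤ κ) (hκ1 : κ ≤ 1) (hJ : Jcov (Fintype.card o) d a' α τ κ < gammaU d a' α τ)
    {u : Tor (fine n M) × o → ℂ} {v : (Tor (fine n M) × Fin d) × o → ℂ}
    (hu : ∀ e, u e ≠ 0 → R' ≤ ρ₀ e.1) (hv : ∀ b, v b ≠ 0 → ρ₀ b.1.1 ≤ 0) :
    ‖star u ⬝ᵥ ((scalarOp n M a' R T)⁻¹ *ᵥ ((covGrad (fine n M) ((n : ℕ) : ℂ) R)ᴴ *ᵥ v))‖
      ≤ Real.exp (-(κ * R')) * gradC (Fintype.card o) d a' α τ κ * (Real.sqrt (nsq u) * Real.sqrt (nsq v)) := by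
  set A := scalarOp n M a' R T with hA
  set D := covGrad (fine n M) ((n : ℕ) : ℂ) R with hD
  -- Hermitian symmetry: `⟨u, A⁻¹Dᴴv⟩ = conj ⟨v, D A⁻¹ u⟩`
  have hAH : (A⁻¹)ᴴ = A⁻¹ := by rw [Matrix.conjTranspose_nonsing_inv, (scalarOp_isHermitian n M a' R T).eq]
  have hMH : (D * A⁻¹)ᴴ = A⁻¹ * Dᴴ := by rw [Matrix.conjTranspose_mul, hAH]
  have hswap : star u ⬝ᵥ (A⁻¹ *ᵥ (Dᴴ *ᵥ v)) = star (star v ⬝ᵥ (D *ᵥ (A⁻¹ *ᵥ u))) := by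
    rw [Matrix.mulVec_mulVec, Matrix.mulVec_mulVec, ← hMH]
    exact star_dotProduct_conjTranspose_mulVec (D * A⁻¹) u v
  rw [hswap, norm_star]
  -- the reversed weight `σ₀ = R′ − ρ₀`
  have hlip' : ∀ x ν, |(R' - ρ₀ (x + unitVec (fine n M) ν)) - (R' - ρ₀ x)| ≤ 1 / n := fun x ν => by
    rw [show (R' - ρ₀ (x + unitVec (fine n M) ν)) - (R' - ρ₀ x) = -(ρ₀ (x + unitVec (fine n M) ν) - ρ₀ x) by ring, abs_neg]; exact hlip x ν
  have hosc' : ∀ x x', blockOf n M x = blockOf n M x' → |(R' - ρ₀ x) - (R' - ρ₀ x')| ≤ 1 := fun x x' h => by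
    rw [show (R' - ρ₀ x) - (R' - ρ₀ x') = -(ρ₀ x - ρ₀ x') by ring, abs_neg]; exact hosc x x' h
  have h := covGrad_scalarOp_inv_pairing_decay n M ha' hα hτ h2 hR hT (ρ₀ := fun x => R' - ρ₀ x) hlip' hosc' hκ0 hκ1 hJ
    (u := v) (v := u) (R' := R') (fun b hb => by have := hv b hb; linarith) (fun e he => by have := hu e he; linarith)
  rw [mul_comm (Real.sqrt (nsq u))]
  exact h

/-! ## §4 Entry forms in unit-lattice distance at the explicit rate `κ_U` -/

omit hM in

/-- the gradient decay constant at the explicit rate: `C_∇ = gradConst = 2(√γ_U + 2√d·co·(1+α)κ_U)/γ_U`. [folklore] -/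
def gradConst (co d : ℕ) (a' α τ : ℝ) : ℝ :=
  2 * (Real.sqrt (gammaU d a' α τ) + 2 * Real.sqrt d * co * (1 + α) * kappaU co d a' α τ) / gammaU d a' α τ

omit [Fintype o] [DecidableEq o] [NeZero n] hM in
/-- at the explicit rate, `gradC ≤ gradConst`. [folklore] -/
theorem gradC_kappaU_le (co d : ℕ) {a' α τ : ℝ} (ha' : 0 ≤ a') (hα : 0 ≤ α) (hγ : 0 < gammaU d a' α τ) :
    gradC co d a' α τ (kappaU co d a' α τ) ≤ gradConst co d a' α τ := by
  have hJ := Jcov_kappaU_le co d ha' hα hγ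
  have hk := (kappaU_pos co d ha' hα hγ).le
  unfold gradC gradConst
  rw [div_le_div_iff₀ (by linarith) hγ]
  have hnum : 0 ≤ Real.sqrt (gammaU d a' α τ) + 2 * Real.sqrt d * co * (1 + α) * kappaU co d a' α τ := by positivity
  nlinarith

/-- **ENTRY DECAY OF `D_R·G′(U)`, CLOSED FORM**: in the small-field regime `γ_U > 0`, for every level `n = L^j`, every torus with `n·M_μ ≥ 2` and
all entries, `‖(D_RS_U⁻¹)(((x,ν),α),(x′,α′))‖ ≤ gradConst·e^{−κ_U·dist_∞(x,x′)/n}` with `κ_U = kappaU (card o) d a′ α τ`.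
[cite: Balaban1985BackgroundPropagators, Thm 3.1 (3.42) p.397 (second entry, entry shadow, one region; route and constants ours)] [folklore] -/
theorem covGrad_scalarOp_inv_entry_decay_explicit (ha' : 0 < a') (hα : 0 ≤ α) (hτ : 0 ≤ τ) (h2 : ∀ μ, 2 ≤ fine n M μ)
    (hR : ∀ μ x, ‖connS (fine n M) ((n : ℕ) : ℂ) R μ x‖ ≤ α) (hT : ∀ x, ‖T x - 1‖ ≤ τ) (hγ : 0 < gammaU d a' α τ)
    (b : (Tor (fine n M) × Fin d) × o) (e' : Tor (fine n M) × o) :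
    ‖(covGrad (fine n M) ((n : ℕ) : ℂ) R * (scalarOp n M a' R T)⁻¹) b e'‖
      ≤ gradConst (Fintype.card o) d a' α τ * Real.exp (-(kappaU (Fintype.card o) d a' α τ * (ldist (fine n M) b.1.1 e'.1 / n))) := by
  have hn0 : (0 : ℝ) < n := by exact_mod_cast Nat.pos_of_ne_zero (NeZero.ne n)
  set κ := kappaU (Fintype.card o) d a' α τ with hκ
  have hk := kappaU_nonneg_le_one (Fintype.card o) d ha'.le hα hγ
  have hJ' : Jcov (Fintype.card o) d a' α τ κ < gammaU d a' α τ := by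
    have := Jcov_kappaU_le (Fintype.card o) d ha'.le hα hγ; rw [← hκ] at this; linarith
  set Ts : Finset (Tor (fine n M)) := {e'.1} with hTs
  have hTs' : Ts.Nonempty := Finset.singleton_nonempty _
  set R' : ℝ := ldist (fine n M) b.1.1 e'.1 / n with hR'
  have h := covGrad_scalarOp_inv_pairing_decay n M ha' hα hτ h2 hR hT (rhoS_lipschitz n M h2 Ts hTs') (rhoS_osc n M Ts hTs') hk.1 hk.2 hJ'
    (u := Pi.single b (1 : ℂ)) (v := Pi.single e' (1 : ℂ)) (R' := R')
    (fun i hi => by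
      have hie : i = b := by by_contra hne; exact hi (by rw [Pi.single_apply, if_neg hne])
      rw [hie, hR', rhoS]
      have hd := le_distTo (ldist (fine n M)) Ts hTs' (j := b.1.1) (r := ldist (fine n M) b.1.1 e'.1)
        (fun t ht => by rw [hTs, Finset.mem_singleton] at ht; rw [ht])
      calc ldist (fine n M) b.1.1 e'.1 / n = 1 / n * ldist (fine n M) b.1.1 e'.1 := by ring
        _ ≤ 1 / n * distTo (ldist (fine n M)) Ts hTs' b.1.1 := mul_le_mul_of_nonneg_left hd (by positivity))
    (fun i hi => by
      have hie : i = e' := by by_contra hne; exact hi (by rw [Pi.single_apply, if_neg hne])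
      rw [hie, rhoS]
      exact mul_nonpos_iff.mpr (Or.inl ⟨by positivity, distTo_le_zero_of_mem (ldist (fine n M)) (ldist_self _) Ts hTs'
        (by rw [hTs, Finset.mem_singleton])⟩))
  rw [nsq_single, nsq_single, Real.sqrt_one, mul_one, mul_one] at h
  have hentry : star (Pi.single b (1 : ℂ)) ⬝ᵥ (covGrad (fine n M) ((n : ℕ) : ℂ) R *ᵥ ((scalarOp n M a' R T)⁻¹ *ᵥ Pi.single e' 1))
      = (covGrad (fine n M) ((n : ℕ) : ℂ) R * (scalarOp n M a' R T)⁻¹) b e' := by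
    rw [Matrix.mulVec_mulVec, Matrix.mulVec_single_one, ← Pi.single_star, star_one, single_dotProduct, one_mul, Matrix.col_apply]
  rw [hentry] at h
  refine h.trans ?_
  rw [mul_comm]
  exact mul_le_mul_of_nonneg_right (gradC_kappaU_le _ d ha'.le hα hγ) (Real.exp_pos _).le

/-- **ENTRY DECAY OF `G′(U)·D_Rᴴ`, CLOSED FORM**: `‖(S_U⁻¹D_Rᴴ)((x,α),((x′,ν),α′))‖ ≤ gradConst·e^{−κ_U·dist_∞(x,x′)/n}`.
[cite: Balaban1985BackgroundPropagators, Thm 3.1 (3.42) p.397 (third entry, entry shadow, one region; route and constants ours)] [folklore] -/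
theorem scalarOp_inv_covGradH_entry_decay_explicit (ha' : 0 < a') (hα : 0 ≤ α) (hτ : 0 ≤ τ) (h2 : ∀ μ, 2 ≤ fine n M μ)
    (hR : ∀ μ x, ‖connS (fine n M) ((n : ℕ) : ℂ) R μ x‖ ≤ α) (hT : ∀ x, ‖T x - 1‖ ≤ τ) (hγ : 0 < gammaU d a' α τ)
    (e : Tor (fine n M) × o) (b : (Tor (fine n M) × Fin d) × o) :
    ‖((scalarOp n M a' R T)⁻¹ * (covGrad (fine n M) ((n : ℕ) : ℂ) R)ᴴ) e b‖
      ≤ gradConst (Fintype.card o) d a' α τ * Real.exp (-(kappaU (Fintype.card o) d a' α τ * (ldist (fine n M) e.1 b.1.1 / n))) := by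
  have hAH : ((scalarOp n M a' R T)⁻¹)ᴴ = (scalarOp n M a' R T)⁻¹ := by
    rw [Matrix.conjTranspose_nonsing_inv, (scalarOp_isHermitian n M a' R T).eq]
  have hT' : ((scalarOp n M a' R T)⁻¹ * (covGrad (fine n M) ((n : ℕ) : ℂ) R)ᴴ) e b
      = star ((covGrad (fine n M) ((n : ℕ) : ℂ) R * (scalarOp n M a' R T)⁻¹) b e) := by
    rw [← Matrix.conjTranspose_apply, Matrix.conjTranspose_mul, hAH]
  rw [hT', norm_star, Literature.MathematicalPhysics.QuantumFieldTheory.Balaban1983to89.Beta.TorusG0Decay.ldist_symm]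
  exact covGrad_scalarOp_inv_entry_decay_explicit n M ha' hα hτ h2 hR hT hγ b e

end Decay

end Summit.QuantumFields.BalabanUV.T4Continuum.ScalarCovariantGreenGradDecay

end
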